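import Literature.MathematicalPhysics.QuantumFieldTheory.Balaban1983to89.Node00.Record13MonotoneHistoryOfBetaSign

/-!
# NODE 00 (YM-PLAN Track A) — STAGE 13: THE REVERSE COMPARABILITY CLAUSE `ε_{m+1} ≤ 2·ε_m` ALONG WINDOWED RUNS FROM THE TWO-SIDED β-BOX (print [III] (2.6)–(2.8) read
# BOTH ways) — the numerics input of the repaired binder block C′ of the [15]-facts of record (dag-n07-e LOCATED-M4 «FREE δ₀»: add `∀ n < k, δ (n + 1) ≤ 2·δ n`)

Cell `pub-ymgap`, seat `pub-ymgap-node00-def-K0a` (g7), FILE 14d (sequel of 13e `Record13MonotoneHistoryOfBetaSign` and node00-def-P11 FILE 6 `Record12BgRowHistory`, whose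
`hcomp_genSeq_of_betaBox` is the FORWARD clause `ε_m ≤ 2·ε_{m+1}`).  [III] = [Balaban1988Convergent], [I] = [Balaban1987RG1], [15] = [Balaban1985Variational].

WHY (dag-n07-e g8 LOCATED-M4, pub-ymgap INBOX 2026-08-27T08:22Z; dag-lead DEDUP-266 (9)).  The three typed [15] facts of record (`VariationalThm1RegSepPrinted` ∕ `…PrintedCo` ∕
`VariationalThm1RegSepCo6`) bound the level-0 threshold `δ 0` only from above (`δ n ≤ 2·δ (n+1)`), while their n = 0 conclusion ranges over every fine plaquette; print has ONE
`ε₁` for all scales, so the per-scale reading needs (2.8) in BOTH directions.  The repair C′ adds the clause `∀ n < k, δ (n + 1) ≤ 2·δ n`; at the run objects of record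
(`δ n := cR·ε_n`, `ε_n = g_n·A₀·(log g_n⁻²)^{p₀}` of (2.4) along `g = genSeq β g₀` of (0.20)) this is `ε_{m+1} ≤ 2·ε_m`, which holds in the window whenever the record's
β-functions are BOUNDED ON BOTH SIDES on the window box: `β ≥ b ≥ 0` keeps the history non-decreasing (so `log g⁻²` does not grow), and `β ≤ β′` with `β′γ² ≤ ¾` keeps one step
from more than doubling the coupling (`g_{m+1}⁻² = g_m⁻² − β_m ≥ ¼·g_m⁻²`).  Both bounds are DISPLAYED hypotheses (`FlowStep.BetaLowerH` — the tree's located AF sign input;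
`FlowStep.BetaUpperH` — [I] p. 264 «uniformly bounded», the (D4) lane's currency); nothing of Bałaban asserted.

WHAT THIS FILE PROVES (theorems only; 0 `def`).
* §1 (history-generic) `epsOfRecord_succ_le_two_mul_of_step` (one scale: `0 < g_m ≤ g_{m+1} ≤ 1`, `g_m⁻² ≤ g_{m+1}⁻² + β′`, `β′g_m² ≤ ¾` ⇒ `ε_{m+1} ≤ 2ε_m`), ★
  `hcompRev_genSeq_of_betaBox` (along `genSeq β g₀` in the window `]0, γ]`, `γ ≤ 1`, from `BetaLowerH b γ β` (`0 ≤ b`), `BetaUpperH β′ γ β` and the ONE letter `β′γ² ≤ ¾`),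
  `hcompRev_mul_of_hcompRev` (the `cR`-form).
* §2 (generic `θ`) ★ `Stage13Params.hcompRev_of_betaBox (θ) (hA : 0 ≤ θ.ν.A₀) (hγ1 : θ.γ ≤ 1) (hcR : 0 ≤ θ.s2.cR) (hb) (hlow) (hup) (hletter)` :
  `∀ p n, n ≤ p.K → window → ∀ m < n, cR·ε_{m+1} ≤ 2·(cR·ε_m)` along `gOfRecord₁₃ F N θ p`.
* §3 (at `θ₁₅ᶜᶜ¹ = theta13OfThm1CC1 F N ε₀ ε₂₉ B₃ B₃' a₀ a₁`, `γ = ½`, `cR = 1`, `A₀ = A₀ᶜᶜ¹ ≥ 0`) ★★ `hcompRev_theta13OfThm1CC1_of_betaBox (hB hB' ha₀ ha₁) (hb) (hlow) (hup : FlowStep.BetaUpperH β′ ½ β₁₃(θ₁₅ᶜᶜ¹))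
  (hβ′ : β′ ≤ 3)` and the TWO-SIDED pair ★★ `hcompBoth_theta13OfThm1CC1_of_betaBox` = (13e's forward `hcomp_…_of_betaLowerH`, §3's reverse) — the (hcomp, hcompRev) inputs of the C′-keyed supplier.

HONEST FRAMING.  Elementary real analysis + bookkeeping; CONDITIONAL on the DISPLAYED two-sided β-box; nothing of Bałaban asserted; NOT a discharge; K0⁗∕K0⁵ NOT closed; counts unmoved
(typed 28∕28 · discharged 5∕28); one finite 𝕋⁴ programme at fixed ε — NOT continuum ∕ OS ∕ mass gap ∕ Clay.  No `sorry`, `axiom`, `def`, `instance`, `notation`.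
-/

noncomputable section

namespace Literature.MathematicalPhysics.QuantumFieldTheory.Balaban1983to89.Node00

open T4Continuum FlowStep FlowStepRuns
open FlowStep (HBeta prefixOf Box mem_box BetaLowerH BetaUpperH)
open B15Claim189N0OfRecord (genSeq_le_succ_of_beta_nonneg)
open B14FlowStep (log_inv_sq_nonneg)

/-! ## §1. History-generic: one scale, then along `genSeq β g₀` in the window from the two-sided β-box -/

section Step

/-- **(2.8) REVERSED ACROSS ONE SCALE**: if `0 < g_m ≤ g_{m+1} ≤ 1`, `g_m⁻² ≤ g_{m+1}⁻² + β′` ((0.20) with `β_m ≤ β′`) and `β′·g_m² ≤ ¾`, then `g_{m+1} ≤ 2g_m` and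
`log g_{m+1}⁻² ≤ log g_m⁻²`, hence `ε_{m+1} ≤ 2·ε_m` for the thresholds `ε_j = g_j·A₀·(log g_j⁻²)^{p₀}` of (2.4) (`0 ≤ A₀`). [cite: Balaban1988Convergent, (2.4) p.255, (2.6)–(2.8) pp.255–256; Balaban1987RG1, (0.20) p.256] -/
theorem epsOfRecord_succ_le_two_mul_of_step (ν : Stage7Numerics) (hA : 0 ≤ ν.A₀) {g : ℕ → ℝ} {m : ℕ} {β' : ℝ}
    (hgm : 0 < g m) (hle : g m ≤ g (m + 1)) (hg1 : g (m + 1) ≤ 1)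
    (hstep : (g m ^ 2)⁻¹ ≤ (g (m + 1) ^ 2)⁻¹ + β') (hsmall : β' * g m ^ 2 ≤ 3 / 4) :
    epsOfRecord ν g (m + 1) ≤ 2 * epsOfRecord ν g m := by
  have hgm' : 0 < g (m + 1) := hgm.trans_le hle
  have ha2 : 0 < g m ^ 2 := pow_pos hgm 2
  have hc2 : 0 < g (m + 1) ^ 2 := pow_pos hgm' 2
  -- clear denominators in the step inequality: `g_{m+1}² ≤ g_m² + β′·g_m²·g_{m+1}²`
  have h1 : g (m + 1) ^ 2 ≤ g m ^ 2 + β' * (g m ^ 2 * g (m + 1) ^ 2) := by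
    have h := mul_le_mul_of_nonneg_right hstep (le_of_lt (mul_pos ha2 hc2))
    have e1 : (g m ^ 2)⁻¹ * (g m ^ 2 * g (m + 1) ^ 2) = g (m + 1) ^ 2 := by
      rw [← mul_assoc, inv_mul_cancel₀ ha2.ne', one_mul]
    have e2 : ((g (m + 1) ^ 2)⁻¹ + β') * (g m ^ 2 * g (m + 1) ^ 2) = g m ^ 2 + β' * (g m ^ 2 * g (m + 1) ^ 2) := by
      rw [add_mul, mul_comm (g m ^ 2) (g (m + 1) ^ 2), ← mul_assoc, inv_mul_cancel₀ hc2.ne', one_mul, mul_comm (g (m + 1) ^ 2) (g m ^ 2)]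
    rwa [e1, e2] at h
  -- with `β′g_m² ≤ ¾`: `¼·g_{m+1}² ≤ g_m²`, so `g_{m+1} ≤ 2g_m`
  have h2 : g (m + 1) ^ 2 ≤ (2 * g m) ^ 2 := by
    have hq : 0 ≤ g (m + 1) ^ 2 * (3 / 4 - β' * g m ^ 2) := mul_nonneg hc2.le (by linarith)
    nlinarith [h1, hq]
  have h3 : g (m + 1) ≤ 2 * g m := (pow_le_pow_iff_left₀ hgm'.le (by positivity) two_ne_zero).mp h2
  -- the logarithm does not grow along a non-decreasing history, and stays nonnegative below `1`
  have hlog : Real.log (g (m + 1) ^ 2)⁻¹ ≤ Real.log (g m ^ 2)⁻¹ :=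
    Real.log_le_log (inv_pos.mpr hc2) (inv_anti₀ ha2 (pow_le_pow_left₀ hgm.le hle 2))
  have hlog0 : 0 ≤ Real.log (g (m + 1) ^ 2)⁻¹ := log_inv_sq_nonneg hgm' hg1
  have hpow : Real.log (g (m + 1) ^ 2)⁻¹ ^ ν.p₀ ≤ Real.log (g m ^ 2)⁻¹ ^ ν.p₀ := pow_le_pow_left₀ hlog0 hlog _
  unfold epsOfRecord p0Profile
  calc g (m + 1) * (ν.A₀ * Real.log (g (m + 1) ^ 2)⁻¹ ^ ν.p₀)
      ≤ (2 * g m) * (ν.A₀ * Real.log (g m ^ 2)⁻¹ ^ ν.p₀) :=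
        mul_le_mul h3 (mul_le_mul_of_nonneg_left hpow hA) (mul_nonneg hA (pow_nonneg hlog0 _)) (by positivity)
    _ = 2 * (g m * (ν.A₀ * Real.log (g m ^ 2)⁻¹ ^ ν.p₀)) := by ring

/-- **★ THE REVERSE COMPARABILITY CLAUSE ALONG `genSeq β g₀` FROM THE WINDOW AND THE TWO-SIDED β-BOX**: if `0 < g_j ≤ γ` for `j ≤ n` (`Step.InInterval γ n`), `γ ≤ 1`,
the β-functions satisfy `b ≤ β_j ≤ β′` on the boxes `]0, γ]^{j+1}` (`FlowStep.BetaLowerH b γ β` with `0 ≤ b`, `FlowStep.BetaUpperH β′ γ β` — DISPLAYED), `0 ≤ A₀`, and the ONE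
letter `β′·γ² ≤ ¾` holds, then `ε_{m+1} ≤ 2·ε_m` for every `m < n` ((0.20): `g_{m+1}⁻² = g_m⁻² − β_m`). [cite: Balaban1988Convergent, (2.4) p.255, (2.6)–(2.8) pp.255–256; Balaban1987RG1, (0.20) p.256, §1 p.264] -/
theorem hcompRev_genSeq_of_betaBox (ν : Stage7Numerics) (hA : 0 ≤ ν.A₀) {β : HBeta} {g0 γ b β' : ℝ} {n : ℕ}
    (hI : Step.InInterval γ n (genSeq β g0)) (hγ1 : γ ≤ 1) (hb : 0 ≤ b) (hlo : BetaLowerH b γ β) (hup : BetaUpperH β' γ β)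
    (hletter : β' * γ ^ 2 ≤ 3 / 4) :
    ∀ m, m < n → epsOfRecord ν (genSeq β g0) (m + 1) ≤ 2 * epsOfRecord ν (genSeq β g0) m := by
  intro m hm
  have hgm := hI m hm.le
  have hgm' := hI (m + 1) hm
  have hbox : prefixOf (genSeq β g0) m ∈ Box γ m :=
    mem_box.mpr fun i => hI i (by have := i.isLt; omega)
  have hβlo : 0 ≤ β m (prefixOf (genSeq β g0) m) := hb.trans (hlo m _ hbox)
  have hβup : β m (prefixOf (genSeq β g0) m) ≤ β' := hup m _ hbox
  have hle : genSeq β g0 m ≤ genSeq β g0 (m + 1) := genSeq_le_succ_of_beta_nonneg β g0 hgm.1 hgm'.1 hβlo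
  have hstep : (genSeq β g0 m ^ 2)⁻¹ ≤ (genSeq β g0 (m + 1) ^ 2)⁻¹ + β' := by
    rw [inv_sq_genSeq_succ β g0 hgm'.1]; linarith
  have hsmall : β' * genSeq β g0 m ^ 2 ≤ 3 / 4 :=
    (mul_le_mul_of_nonneg_left (pow_le_pow_left₀ hgm.1.le hgm.2 2) (hβlo.trans hβup)).trans hletter
  exact epsOfRecord_succ_le_two_mul_of_step ν hA hgm.1 hle (hgm'.2.trans hγ1) hstep hsmall

/-- The `cR`-form of the reverse clause (multiply by `0 ≤ cR`). [cite: Balaban1988Convergent, (2.8) p.256 (bookkeeping)] -/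
theorem hcompRev_mul_of_hcompRev (ν : Stage7Numerics) {g : ℕ → ℝ} {n : ℕ} {cR : ℝ} (hcR : 0 ≤ cR)
    (h : ∀ m, m < n → epsOfRecord ν g (m + 1) ≤ 2 * epsOfRecord ν g m) :
    ∀ m, m < n → cR * epsOfRecord ν g (m + 1) ≤ 2 * (cR * epsOfRecord ν g m) := fun m hm => by
  have := mul_le_mul_of_nonneg_left (h m hm) hcR
  linarith

end Step

/-! ## §2. At a generic Stage-13 parameter: the reverse clause along every windowed run from the two-sided β-box of the record's β-functions -/

section Generic

variable {F : T4Family} {N : ℕ} [NeZero N]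

/-- **★ THE REVERSE COMPARABILITY CLAUSE ALONG EVERY WINDOWED RUN OF THE STAGE-13 RECORD** (`gOfRecord₁₃ θ p = genSeq β₁₃(θ) g₀(p)`): for `n ≤ K`, a history in `]0, θ.γ]` up
to `n` (`θ.γ ≤ 1`) and `m < n`, `cR·ε_{m+1} ≤ 2·(cR·ε_m)` — from `BetaLowerH b θ.γ β₁₃(θ)` (`0 ≤ b`), `BetaUpperH β′ θ.γ β₁₃(θ)`, `β′·θ.γ² ≤ ¾`, `0 ≤ A₀`, `0 ≤ cR`.  CONDITIONAL on
the displayed β-box; nothing of Bałaban asserted. [cite: Balaban1988Convergent, (2.4) p.255, (2.6)–(2.8) pp.255–256; Balaban1987RG1, (0.20) p.256, Thm 2 p.259, §1 p.264] -/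
theorem Stage13Params.hcompRev_of_betaBox (θ : Stage13Params F N) (hA : 0 ≤ θ.ν.A₀) (hγ1 : θ.γ ≤ 1) (hcR : 0 ≤ θ.s2.cR)
    {b β' : ℝ} (hb : 0 ≤ b) (hlow : BetaLowerH b θ.γ (betaOfRecord₁₃ F N θ)) (hup : BetaUpperH β' θ.γ (betaOfRecord₁₃ F N θ))
    (hletter : β' * θ.γ ^ 2 ≤ 3 / 4) :
    ∀ (p : B12.RunParams) (n : ℕ), n ≤ p.K → Step.InInterval θ.γ n (gOfRecord₁₃ F N θ p) → ∀ m, m < n →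
      θ.s2.cR * epsOfRecord θ.ν (gOfRecord₁₃ F N θ p) (m + 1) ≤ 2 * (θ.s2.cR * epsOfRecord θ.ν (gOfRecord₁₃ F N θ p) m) :=
  fun _ _ _ hw => hcompRev_mul_of_hcompRev θ.ν hcR (hcompRev_genSeq_of_betaBox θ.ν hA hw hγ1 hb hlow hup hletter)

end Generic

/-! ## §3. At `θ₁₅ᶜᶜ¹`: the reverse clause and the two-sided pair from the β-box on `]0, ½]` -/

section AtWitness

variable {F : T4Family} {N : ℕ} [NeZero N] {ε₀ ε₂₉ B₃ B₃' a₀ a₁ : ℝ}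

/-- **★★ THE REVERSE COMPARABILITY CLAUSE AT `θ₁₅ᶜᶜ¹`** (`γ = ½`, `cR = 1`, `A₀ = A₀ᶜᶜ¹ ≥ 0` under the weak signs): `cR·ε_{m+1} ≤ 2·(cR·ε_m)` along every windowed run, from
`BetaLowerH b ½ β₁₃(θ₁₅ᶜᶜ¹)` (`0 ≤ b`) and `BetaUpperH β′ ½ β₁₃(θ₁₅ᶜᶜ¹)` with `β′ ≤ 3` (so `β′·¼ ≤ ¾`) — the new clause of the repaired [15]-fact block C′ at the witness.
CONDITIONAL on the displayed β-box; nothing of Bałaban asserted. [cite: Balaban1988Convergent, (2.4) p.255, (2.6)–(2.8) pp.255–256; Balaban1987RG1, (0.20) p.256, §1 p.264; Balaban1985Variational, Thm 1 p.279] -/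
theorem hcompRev_theta13OfThm1CC1_of_betaBox (hB : 0 ≤ B₃) (hB' : 0 ≤ B₃') (ha₀ : 0 ≤ a₀) (ha₁ : 0 ≤ a₁)
    {b β' : ℝ} (hb : 0 ≤ b) (hlow : BetaLowerH b (1 / 2) (betaOfRecord₁₃ F N (theta13OfThm1CC1 F N ε₀ ε₂₉ B₃ B₃' a₀ a₁)))
    (hup : BetaUpperH β' (1 / 2) (betaOfRecord₁₃ F N (theta13OfThm1CC1 F N ε₀ ε₂₉ B₃ B₃' a₀ a₁))) (hβ' : β' ≤ 3) :
    ∀ (p : B12.RunParams) (n : ℕ), n ≤ p.K → Step.InInterval (theta13OfThm1CC1 F N ε₀ ε₂₉ B₃ B₃' a₀ a₁).γ n (gOfRecord₁₃ F N (theta13OfThm1CC1 F N ε₀ ε₂₉ B₃ B₃' a₀ a₁) p) → ∀ m, m < n →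
      (theta13OfThm1CC1 F N ε₀ ε₂₉ B₃ B₃' a₀ a₁).s2.cR * epsOfRecord (theta13OfThm1CC1 F N ε₀ ε₂₉ B₃ B₃' a₀ a₁).ν (gOfRecord₁₃ F N (theta13OfThm1CC1 F N ε₀ ε₂₉ B₃ B₃' a₀ a₁) p) (m + 1) ≤ 2 * ((theta13OfThm1CC1 F N ε₀ ε₂₉ B₃ B₃' a₀ a₁).s2.cR * epsOfRecord (theta13OfThm1CC1 F N ε₀ ε₂₉ B₃ B₃' a₀ a₁).ν (gOfRecord₁₃ F N (theta13OfThm1CC1 F N ε₀ ε₂₉ B₃ B₃' a₀ a₁) p) m) :=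
  (theta13OfThm1CC1 F N ε₀ ε₂₉ B₃ B₃' a₀ a₁).hcompRev_of_betaBox (by rw [theta13OfThm1CC1_A₀]; exact A0OfThm1CC1_nonneg hB hB' ha₀ ha₁) (by rw [theta13OfThm1CC1_γ]; norm_num)
    (by rw [theta13OfThm1CC1_cR]; norm_num) hb ((theta13OfThm1CC1_γ F N ε₀ ε₂₉ B₃ B₃' a₀ a₁).symm ▸ hlow) ((theta13OfThm1CC1_γ F N ε₀ ε₂₉ B₃ B₃' a₀ a₁).symm ▸ hup)
    (by rw [theta13OfThm1CC1_γ]; linarith)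

/-- **★★ THE TWO-SIDED COMPARABILITY PAIR AT `θ₁₅ᶜᶜ¹`** — (hcomp) `cR·ε_m ≤ 2·(cR·ε_{m+1})` (FILE 13e, from the sign) AND (hcompRev) `cR·ε_{m+1} ≤ 2·(cR·ε_m)` (§3), from the
β-box `b ≤ β₁₃ ≤ β′` on `]0, ½]` with `0 ≤ b`, `β′ ≤ 3`: the two comparability inputs of the C′-keyed [15]-fact supplier at the witness. CONDITIONAL; nothing of Bałaban asserted.
[cite: Balaban1988Convergent, (2.6)–(2.8) pp.255–256; Balaban1987RG1, (0.20) p.256, §1 p.264; Balaban1985Variational, Thm 1 p.279] -/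
theorem hcompBoth_theta13OfThm1CC1_of_betaBox (hB : 0 ≤ B₃) (hB' : 0 ≤ B₃') (ha₀ : 0 ≤ a₀) (ha₁ : 0 ≤ a₁)
    {b β' : ℝ} (hb : 0 ≤ b) (hlow : BetaLowerH b (1 / 2) (betaOfRecord₁₃ F N (theta13OfThm1CC1 F N ε₀ ε₂₉ B₃ B₃' a₀ a₁)))
    (hup : BetaUpperH β' (1 / 2) (betaOfRecord₁₃ F N (theta13OfThm1CC1 F N ε₀ ε₂₉ B₃ B₃' a₀ a₁))) (hβ' : β' ≤ 3) :
    (∀ (p : B12.RunParams) (n : ℕ), n ≤ p.K → Step.InInterval (theta13OfThm1CC1 F N ε₀ ε₂₉ B₃ B₃' a₀ a₁).γ n (gOfRecord₁₃ F N (theta13OfThm1CC1 F N ε₀ ε₂₉ B₃ B₃' a₀ a₁) p) → ∀ m, m < n →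
      (theta13OfThm1CC1 F N ε₀ ε₂₉ B₃ B₃' a₀ a₁).s2.cR * epsOfRecord (theta13OfThm1CC1 F N ε₀ ε₂₉ B₃ B₃' a₀ a₁).ν (gOfRecord₁₃ F N (theta13OfThm1CC1 F N ε₀ ε₂₉ B₃ B₃' a₀ a₁) p) m ≤ 2 * ((theta13OfThm1CC1 F N ε₀ ε₂₉ B₃ B₃' a₀ a₁).s2.cR * epsOfRecord (theta13OfThm1CC1 F N ε₀ ε₂₉ B₃ B₃' a₀ a₁).ν (gOfRecord₁₃ F N (theta13OfThm1CC1 F N ε₀ ε₂₉ B₃ B₃' a₀ a₁) p) (m + 1))) ∧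
    (∀ (p : B12.RunParams) (n : ℕ), n ≤ p.K → Step.InInterval (theta13OfThm1CC1 F N ε₀ ε₂₉ B₃ B₃' a₀ a₁).γ n (gOfRecord₁₃ F N (theta13OfThm1CC1 F N ε₀ ε₂₉ B₃ B₃' a₀ a₁) p) → ∀ m, m < n →
      (theta13OfThm1CC1 F N ε₀ ε₂₉ B₃ B₃' a₀ a₁).s2.cR * epsOfRecord (theta13OfThm1CC1 F N ε₀ ε₂₉ B₃ B₃' a₀ a₁).ν (gOfRecord₁₃ F N (theta13OfThm1CC1 F N ε₀ ε₂₉ B₃ B₃' a₀ a₁) p) (m + 1) ≤ 2 * ((theta13OfThm1CC1 F N ε₀ ε₂₉ B₃ B₃' a₀ a₁).s2.cR * epsOfRecord (theta13OfThm1CC1 F N ε₀ ε₂₉ B₃ B₃' a₀ a₁).ν (gOfRecord₁₃ F N (theta13OfThm1CC1 F N ε₀ ε₂₉ B₃ B₃' a₀ a₁) p) m)) :=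
  ⟨hcomp_theta13OfThm1CC1_of_betaLowerH hB hB' ha₀ ha₁ hb hlow, hcompRev_theta13OfThm1CC1_of_betaBox hB hB' ha₀ ha₁ hb hlow hup hβ'⟩

end AtWitness

end Literature.MathematicalPhysics.QuantumFieldTheory.Balaban1983to89.Node00

end
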